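import Summits.QuantumFields.YangMills.Theorems.BalabanUVNodesN21CollarJunctionLowCentre

/-!
# N21 (NE7c) · A6 WITNESS of the doubly-discharged collar junction on the low-centre road (38m′)

R141 (C) seat pub-ymgap-dag-n21-e (g16), node N21 = NE7c (single-run shell-weight bound, NOT PRINTED in [Bałaban
1983–89], NOT proved), strategy s3 ALTERNATIVE CURRENCY, lane K3⁷ `SpineGivenEndpointR13SepCoPH`
(stmt-QuantumFields-20544, `--kind proof --supports … --as helper`).  Sibling of 38m `…N21CollarJunctionLowCentre`
(split for the 400-line rule): the ★★★ END `slotAntiConcentration_restrict_of_lowCentre_letterwise` APPLIED with EVERY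
binder discharged in the kernel (director-ym STANDING A6 RULE №189 (3)) — exterior `X = Unit` under `dirac ()`, block
`ℝ²`, kept cut `K = {|w₁| < 1}` (convex, reads no collar coordinate: 38m §1 `condOdds_keptCuts` exercised on 38l §2's
Gaussian species), potential `φ = Σᵢ wᵢ²∕2` (convex), centre `m = 0 ∈ K` (low), statistic `U = |w₁|` (transversal,
`κ₀ = 1`, `θ = 1`, `ρ = ½`), `C⋆ = univ`, ONE collar coordinate `0` with the letter `(−1, 1)` carried into
`(−7∕6, 7∕6)` at odds `2c∕(1−c)`, `c = e∕3`, core fibres star-convex about `0` (38m §2 `hcore_of_starConvex`).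
`convex_absSlab`, `convexOn_gaussianPotential_two` are the two convexity facts the witness needs.

HONEST FRAMING.  [textbook]; 0 def, 0 sorry; a satisfiability witness, not an estimate on Bałaban's measure; NE7c NOT
PRINTED ∕ NOT proved; N21 NOT discharged; counts unmoved (typed 28∕28 · discharged 5∕27); count-neutral; one finite 𝕋⁴
at fixed ε — nothing about ℝ⁴ ∕ OS ∕ mass gap ∕ Clay.
-/

set_option autoImplicit false

open MeasureTheory Set Function
open scoped ENNReal

namespace Summit.QuantumFields.YangMills.Theorems.N21CollarJunctionLowCentreSanity

open Literature.MathematicalPhysics.QuantumFieldTheory.Balaban1983to89.T4ShellMeasure (SlotAntiConcentration)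
open Summit.QuantumFields.YangMills.Theorems.N21CollarOddsBlockFrame (isFiniteMeasure_blockGaussianWeight)
open Summit.QuantumFields.YangMills.Theorems.N21CollarLetterOdds (gaussianBlock_inwardSlopes)
open Summit.QuantumFields.YangMills.Theorems.N21CollarEnvelopeOdds (hodds_absLetter_of_partialSlopes)
open Summit.QuantumFields.YangMills.Theorems.N21CollarJunctionLowCentre

/-- the slab `{w | |w 1| < 1}` of `ℝ²` is convex (two half-spaces of the linear form `w ↦ w 1`). [textbook] -/
theorem convex_absSlab : Convex ℝ {w : Fin 2 → ℝ | |w 1| < 1} := by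
  have hlin : IsLinearMap ℝ fun w : Fin 2 → ℝ => w 1 := ⟨fun _ _ => rfl, fun _ _ => rfl⟩
  have hset : {w : Fin 2 → ℝ | |w 1| < 1} = {w : Fin 2 → ℝ | -1 < w 1} ∩ {w | w 1 < 1} := by
    ext w
    simp only [mem_setOf_eq, mem_inter_iff, abs_lt]
  rw [hset]
  exact (convex_halfSpace_gt hlin (-1)).inter (convex_halfSpace_lt hlin 1)

/-- the Gaussian block potential `w ↦ Σᵢ wᵢ²∕2` on `ℝ²` is convex. [textbook] -/
theorem convexOn_gaussianPotential_two :
    ConvexOn ℝ univ fun w : Fin 2 → ℝ => ∑ i, w i ^ 2 / 2 := by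
  refine ⟨convex_univ, fun x _ y _ a b ha hb hab => ?_⟩
  have hb' : b = 1 - a := by linarith
  subst hb'
  simp only [Fin.sum_univ_two, Pi.add_apply, Pi.smul_apply, smul_eq_mul]
  nlinarith [mul_nonneg (mul_nonneg ha hb) (sq_nonneg (x 0 - y 0)),
    mul_nonneg (mul_nonneg ha hb) (sq_nonneg (x 1 - y 1))]

/-- **A6 WITNESS OF THE ★★★ END** (director-ym STANDING A6 RULE №189 (3)):
`slotAntiConcentration_restrict_of_lowCentre_letterwise` APPLIED with EVERY binder discharged in the kernel — exterior
`X = Unit` under `dirac ()`, block `ℝ²`, kept cut `K = {|w₁| < 1}` (convex, reads no collar coordinate: the odds are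
transported under it by §1 `condOdds_keptCuts` from 38l §2's Gaussian species), potential `φ = Σᵢ wᵢ²∕2` (convex),
centre `m = 0 ∈ K` (low: `φ(0) = 0`), statistic `U = |w₁|` (transversal with `κ₀ = 1`, `θ = 1`, `ρ = ½`), `C⋆ = univ`,
ONE collar coordinate `0` with the letter `(−1, 1)` carried into `(−7∕6, 7∕6)` at odds `2c∕(1−c)`, `c = e∕3`, core
fibres star-convex about `0` (§2 `hcore_of_starConvex`); a satisfiability witness, not an estimate on Bałaban's
measure. [textbook] -/
theorem collarJunctionLowCentre_binders_inhabited :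
    SlotAntiConcentration
      ((((Measure.dirac ()).prod (volume : Measure (Fin 2 → ℝ))).withDensity
          fun p : Unit × (Fin 2 → ℝ) =>
            ({w : Fin 2 → ℝ | |w 1| < 1}).indicator
              (fun w => ENNReal.ofReal (Real.exp (-(∑ i, w i ^ 2 / 2)))) p.2).restrict
        ({p : Unit × (Fin 2 → ℝ) | |p.2 1| < 1} ∩
          (univ ∩ ⋂ i ∈ ({0} : Finset (Fin 2)), {q : Unit × (Fin 2 → ℝ) | q.2 i ∈ Ioo (-1 : ℝ) 1})))
      (fun p : Unit × (Fin 2 → ℝ) => |p.2 1|) 1 (1 / 2)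
      (3 * ((Fintype.card (Fin 2) : ℝ) + 1) *
          (∏ _i ∈ ({0} : Finset (Fin 2)),
            (1 + 2 * (Real.exp 1 * 2 * ((7 : ℝ) / 6 - 1) / (1 - Real.exp 1 * 2 * ((7 : ℝ) / 6 - 1))))) /
        (1 * (1 - 1 / 2))) := by
  haveI := isFiniteMeasure_blockGaussianWeight (κ := Fin 2)
  -- the data
  have hA : Measurable fun p : Unit × (Fin 2 → ℝ) => ∑ i, p.2 i ^ 2 / 2 :=
    Finset.measurable_sum _ fun i _ => (((measurable_pi_apply i).comp measurable_snd).pow_const 2).div_const 2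
  have hF : Measurable fun p : Unit × (Fin 2 → ℝ) => ENNReal.ofReal (Real.exp (-(∑ i, p.2 i ^ 2 / 2))) :=
    ENNReal.measurable_ofReal.comp (Real.measurable_exp.comp hA.neg)
  have hKhat : MeasurableSet {p : Unit × (Fin 2 → ℝ) | p.2 ∈ {w : Fin 2 → ℝ | |w 1| < 1}} :=
    measurableSet_lt ((measurable_pi_apply 1).comp measurable_snd).abs measurable_const
  have hK1 : ∀ (_ : Unit) (w : Fin 2 → ℝ) (y : ℝ),
      update w 0 y ∈ {w : Fin 2 → ℝ | |w 1| < 1} ↔ w ∈ {w : Fin 2 → ℝ | |w 1| < 1} := by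
    intro _ w y
    simp only [mem_setOf_eq, update_of_ne (show (1 : Fin 2) ≠ 0 by decide)]
  have hg : Measurable fun p : Unit × (Fin 2 → ℝ) =>
      ({w : Fin 2 → ℝ | |w 1| < 1}).indicator (fun w => ENNReal.ofReal (Real.exp (-(∑ i, w i ^ 2 / 2)))) p.2 :=
    measurable_fibreIndicator (fun _ : Unit => {w : Fin 2 → ℝ | |w 1| < 1}) hKhat
      (F := fun (_ : Unit) (w : Fin 2 → ℝ) => ENNReal.ofReal (Real.exp (-(∑ i, w i ^ 2 / 2)))) hF
  haveI : IsFiniteMeasure (((Measure.dirac ()).prod (volume : Measure (Fin 2 → ℝ))).withDensity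
      fun p : Unit × (Fin 2 → ℝ) =>
        ({w : Fin 2 → ℝ | |w 1| < 1}).indicator
          (fun w => ENNReal.ofReal (Real.exp (-(∑ i, w i ^ 2 / 2)))) p.2) := by
    rw [withDensity_fibreIndicator_eq_restrict _ (fun _ : Unit => {w : Fin 2 → ℝ | |w 1| < 1}) hKhat
      (fun (_ : Unit) (w : Fin 2 → ℝ) => ENNReal.ofReal (Real.exp (-(∑ i, w i ^ 2 / 2))))]
    infer_instance
  have hU : Measurable fun p : Unit × (Fin 2 → ℝ) => |p.2 1| := ((measurable_pi_apply 1).comp measurable_snd).abs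
  have he : Real.exp 1 * 2 * ((7 : ℝ) / 6 - 1) < 1 := by nlinarith [Real.exp_one_lt_d9]
  have hq0 : 0 ≤ 2 * (Real.exp 1 * 2 * ((7 : ℝ) / 6 - 1) / (1 - Real.exp 1 * 2 * ((7 : ℝ) / 6 - 1))) :=
    mul_nonneg zero_le_two (div_nonneg (by positivity) (sub_nonneg.2 he.le))
  have hl01 : ∀ l ∈ Icc (1 - 1 / ((Fintype.card (Fin 2) : ℝ) + 1)) (1 : ℝ), 0 ≤ l ∧ l ≤ 1 := by
    intro l hl
    have h := hl.1
    simp only [Fintype.card_fin, Nat.cast_ofNat] at h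
    exact ⟨by linarith, hl.2⟩
  refine slotAntiConcentration_restrict_of_lowCentre_letterwise (Measure.dirac ()) (m := fun _ => 0)
    measurable_const (fun _ => {w : Fin 2 → ℝ | |w 1| < 1}) (fun _ w => ∑ i, w i ^ 2 / 2) hg hU
    MeasurableSet.univ {0} (fun _ => Ioo (-1 : ℝ) 1) (fun _ => Ioo (-(7 / 6) : ℝ) (7 / 6))
    (fun _ _ => measurableSet_Ioo) (fun _ _ => measurableSet_Ioo)
    (fun _ _ => Ioo_subset_Ioo (by norm_num) (by norm_num)) _ (fun _ _ => hq0) ?_ ?_ (fun _ _ _ _ _ => by simp)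
    one_pos (by norm_num) (by norm_num) one_pos (fun _ => convex_absSlab)
    (fun _ => convexOn_gaussianPotential_two.subset (subset_univ _) convex_absSlab) ?_ ?_ ?_ ?_ ?_
  · -- hodds: the kept letter on coordinate `0`, transported under the cut `K` (§1) from 38l §2's Gaussian species
    intro i hi C hC hCi
    rw [Finset.mem_singleton] at hi
    subst hi
    exact condOdds_keptCuts ((Measure.dirac ()).prod volume) (fun _ : Unit => {w : Fin 2 → ℝ | |w 1| < 1}) hKhat
      (fun (_ : Unit) (w : Fin 2 → ℝ) => ENNReal.ofReal (Real.exp (-(∑ i, w i ^ 2 / 2)))) hK1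
      measurableSet_Ioo measurableSet_Ioo
      (fun C hC hCi => hodds_absLetter_of_partialSlopes (Measure.dirac ()) hA 0 (by norm_num) (by norm_num)
        (by norm_num) he (gaussianBlock_inwardSlopes 0).1 (gaussianBlock_inwardSlopes 0).2 C hC hCi) C hC hCi
  · -- the slot statistic reads no collar coordinate
    intro i hi z w y
    rw [Finset.mem_singleton] at hi
    subst hi
    show |update w 0 y 1| = |w 1|
    rw [update_of_ne (by decide)]
  · -- the centre lies in the kept cut
    intro _
    show |(0 : Fin 2 → ℝ) 1| < 1
    simp
  · -- hlow: the centre `0` minimises the Gaussian potential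
    intro p _ _ _ _
    exact le_trans (le_of_eq (by simp)) (Finset.sum_nonneg fun i _ => by positivity)
  · -- hletter: the kept letter on coordinate `0` is carried into the relaxed letter (here: into itself)
    intro i hi l hl z w hw
    rw [Finset.mem_singleton] at hi
    subst hi
    obtain ⟨hl0, hl1⟩ := hl01 l hl
    simp only [Pi.add_apply, Pi.zero_apply, Pi.smul_apply, smul_eq_mul, sub_zero, zero_add, mem_Ioo] at hw ⊢
    constructor
    · nlinarith [mul_nonneg hl0 (show (0 : ℝ) ≤ w 0 + 1 by linarith [hw.1])]
    · nlinarith [mul_nonneg hl0 (show (0 : ℝ) ≤ 1 - w 0 by linarith [hw.2])]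
  · -- hcore: the core fibre `{|w₁| < 1}` is convex and contains the centre (§2 `hcore_of_starConvex`)
    have hl₀ : (0 : ℝ) ≤ 1 - 1 / ((Fintype.card (Fin 2) : ℝ) + 1) := by
      simp only [Fintype.card_fin, Nat.cast_ofNat]
      norm_num
    refine hcore_of_starConvex (fun _ => (0 : Fin 2 → ℝ)) (fun p : Unit × (Fin 2 → ℝ) => |p.2 1|) univ hl₀ ?_
    intro p _ _ _
    show StarConvex ℝ (0 : Fin 2 → ℝ)
      {w : Fin 2 → ℝ | |w 1| < 1 ∧ ((p.1, w) : Unit × (Fin 2 → ℝ)) ∈ (univ : Set (Unit × (Fin 2 → ℝ)))}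
    have hset : {w : Fin 2 → ℝ | |w 1| < 1 ∧ ((p.1, w) : Unit × (Fin 2 → ℝ)) ∈ (univ : Set (Unit × (Fin 2 → ℝ)))}
        = {w : Fin 2 → ℝ | |w 1| < 1} := by
      ext w
      simp only [mem_setOf_eq, mem_univ, and_true]
    rw [hset]
    exact convex_absSlab.starConvex (by simp)
  · -- hRT: `U = |w₁|` is radially transversal with `κ₀ = 1` on `{½ ≤ U}`
    intro p h1 _ _ s hs _ _ _
    have h1' : 1 / 2 ≤ |p.2 1| := by have h := h1; norm_num at h; exact h
    simp only [zero_add, sub_zero, Pi.smul_apply, smul_eq_mul]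
    rw [abs_mul, abs_of_nonneg (by linarith : (0 : ℝ) ≤ s)]
    nlinarith [mul_nonneg (show (0 : ℝ) ≤ s - 1 by linarith) (show (0 : ℝ) ≤ |p.2 1| - 1 / 2 by linarith)]

end Summit.QuantumFields.YangMills.Theorems.N21CollarJunctionLowCentreSanity
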